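import Summits.CriticalPhenomena.PercolationContinuityZ3.Theorems.Transplant.Slab111VTerms
import HarnessLib

/-!
# The routing certificate for `ShapedLinkage 3 (Slab111.hexShadow k)`, X: certified terminals satisfy the model's REALIZABILITY test

builds on p205010 (kernel theorem, internal audit signed; external expert review pending) — NOT used in this file.  Lane `prim-bschramm`, seat
`prim-bschramm-p2` (gen 35; class C1b; memo `HOME/bschramm/P2-LATTICES.md` §129); helper file (`--supports stmt-CriticalPhenomena-4575 --as helper`).
Continuation of «Slab111VTerms»: the witness conditions of `Srch.realizableItem` («Slab111VSearch») — the `γ_min`-neighbours `o₁ → E₁ → a₁ ⋯ a₂ → E₂ → o₂`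
certified by `HexShadow.Terminals` map to model neighbour pairs with the required distinctness and column conditions — and the two membership
statements used by the assembly: **`item_mem_needItems`** and **`cfg_mem_configs`**.
[cite: DuminilCopinSidoraviciusTassion2016, §2.3 (proof of Fact 2: u', v', w')]
-/

noncomputable section

namespace Summit.CriticalPhenomena.PercolationContinuityZ3.Theorems.Transplant

open Literature.Probability.Percolation Literature.Probability.LatticeModels SimpleGraph
open scoped Classical

namespace Slab111

variable {k : ℕ}

/-! ## §1 Model pairs of real neighbours -/

/-- The unfiltered model neighbour list of a terminal column at status `s`. [folklore] -/
def nbList (c : Col) (s : ℤ) : List (Col × ℤ) :=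
  Srch.ups.flatMap fun u => [((c.1 + u.1, c.2 + u.2), Srch.nbrStatus s true), ((c.1 - u.1, c.2 - u.2), Srch.nbrStatus s false)]

/-- **Membership in `witnesses`** from the defining conditions. [folklore] -/
theorem mem_witnesses {T : CtxT} {c : Col} {s : ℤ} {c3 : Col} {excl : List (Col × ℤ)} {o a : Col × ℤ}
    (ho : o ∈ nbList c s) (ho0 : 0 ≤ o.2) (ho12 : o.2 ≤ 12) (how : Srch.inWinB T.C.K o.1 = true) (hout : Srch.inWs T o.1 o.2 = false) (hoc : o.1 ≠ c3)
    (ha : a ∈ nbList c s) (ha0 : 0 ≤ a.2) (ha12 : a.2 ≤ 12) (haw : Srch.inWinB T.C.K a.1 = true) (hao : a ≠ o) (hac : a.1 ≠ c3) (hax : a ∉ excl) :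
    (o, a) ∈ Srch.witnesses T c s c3 excl := by
  unfold Srch.witnesses
  simp only [List.mem_flatMap, List.mem_map, List.mem_filter, Bool.and_eq_true, decide_eq_true_eq, Bool.not_eq_true', beq_eq_false_iff_ne, ne_eq,
    Prod.mk.injEq]
  have hax' : excl.contains a = false := by simpa using hax
  exact ⟨o, ⟨⟨List.mem_flatMap.1 ho, ⟨ho0, ho12⟩, how⟩, hout, hoc⟩, a, ⟨⟨List.mem_flatMap.1 ha, ⟨ha0, ha12⟩, haw⟩, ⟨hao, hac⟩, hax'⟩, rfl, rfl⟩

/-- **The model pair of a real neighbour** `v` of a terminal `X` (column `c = rcol z X`, status `s`): it lies in the neighbour list, its status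
represents the level of `v` and is within `[0,12]`, it passes the window test when `v` is in the window, and for an exact terminal status the level of
`v` is pinned by the pair's status. [folklore] -/
theorem model_pair {z : Site 2} {tR tD sR sD : ℕ} (hk : 10 ≤ k) {X v : slab111 k} (hadj : (film k).Adj X v) (hcR : (rcol z X).1 ≤ ((cap3 tR : ℕ) : ℤ)) :
    ∃ up : Bool, (rcol z v, Srch.nbrStatus (statusOf k (lev (X : Site 3))) up) ∈ nbList (rcol z X) (statusOf k (lev (X : Site 3))) ∧
      RepLevel k (Srch.nbrStatus (statusOf k (lev (X : Site 3))) up) (lev (v : Site 3)) ∧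
      0 ≤ Srch.nbrStatus (statusOf k (lev (X : Site 3))) up ∧ Srch.nbrStatus (statusOf k (lev (X : Site 3))) up ≤ 12 ∧
      (HexShadow.InWin z tD sR (sh v) → Srch.inWinB (rkey tR tD sR sD) (rcol z v) = true) ∧
      (statusOf k (lev (X : Site 3)) ≠ 9 → lev (v : Site 3) = levOfExt k (Srch.nbrStatus (statusOf k (lev (X : Site 3))) up)) := by
  have hX0 : 0 ≤ lev (X : Site 3) ∧ lev (X : Site 3) ≤ k := ⟨(exists_eq_vl X).1.2.1, (exists_eq_vl X).1.2.2⟩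
  have hv0 : 0 ≤ lev (v : Site 3) ∧ lev (v : Site 3) ≤ k := ⟨(exists_eq_vl v).1.2.1, (exists_eq_vl v).1.2.2⟩
  obtain ⟨u, hu, up, hcol, hlev⟩ := nbr_pair (z := z) hadj
  have hu1 : -1 ≤ u.1 ∧ u.1 ≤ 1 := by
    have := hu; simp only [Srch.ups, List.mem_cons, List.not_mem_nil, or_false] at this
    rcases this with rfl | rfl | rfl <;> simp
  refine ⟨up, ?_, ?_, ?_, ?_, ?_, ?_⟩
  · rw [hcol]; unfold nbList; exact mem_nbList hu up
  · cases up
    · simp only [Bool.false_eq_true, if_false] at hlev; rw [hlev]; exact repLevel_nbr_down hk (by omega) hX0.2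
    · simp only [if_true] at hlev; rw [hlev]; exact repLevel_nbr_up hk hX0.1 (by omega)
  · cases up
    · simp only [Bool.false_eq_true, if_false] at hlev
      exact (bounds_of_repLevel (repLevel_nbr_down hk (by omega) hX0.2 (k := k)) (by omega) (by omega)).1
    · simp only [if_true] at hlev
      exact (bounds_of_repLevel (repLevel_nbr_up hk hX0.1 (by omega) (k := k)) (by omega) (by omega)).1
  · cases up
    · simp only [Bool.false_eq_true, if_false] at hlev
      exact (bounds_of_repLevel (repLevel_nbr_down hk (by omega) hX0.2 (k := k)) (by omega) (by omega)).2
    · simp only [if_true] at hlev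
      exact (bounds_of_repLevel (repLevel_nbr_up hk hX0.1 (by omega) (k := k)) (by omega) (by omega)).2
  · intro hw
    rw [sh_eq_vcol_rcol z v, hcol] at hw
    rw [hcol]
    cases up
    · simp only [Bool.false_eq_true, if_false] at hw ⊢; exact inWinB_rkey hcR (by simp only; omega) hw
    · simp only [if_true] at hw ⊢; exact inWinB_rkey hcR (by simp only; omega) hw
  · intro hex
    have := nbr_lev_eq_levOfExt hk hX0.1 hX0.2 hex up (by cases up <;> simp at hlev ⊢ <;> omega)
    rw [hlev]; cases up <;> simpa using this

/-- Two neighbours of one vertex over the same column coincide. [folklore] -/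
theorem nbr_eq_of_rcol_eq {z : Site 2} {X v v' : slab111 k} (h : (film k).Adj X v) (h' : (film k).Adj X v') (hc : rcol z v = rcol z v') : v = v' := by
  obtain ⟨u, hu, up, hcol, hlev⟩ := nbr_pair (z := z) h
  obtain ⟨u', hu', up', hcol', hlev'⟩ := nbr_pair (z := z) h'
  apply eq_of_sh_eq_of_lev_eq
  · rw [sh_eq_vcol_rcol z v, sh_eq_vcol_rcol z v', hc]
  · rw [hlev, hlev']
    cases up <;> cases up' <;> simp only [Bool.false_eq_true, if_false, if_true] at hcol hcol' ⊢
    · rw [hc] at hcol; rw [hcol] at hcol'; exact absurd hcol'.symm (ups_ne_neg hu' hu)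
    · rw [hc] at hcol; rw [hcol] at hcol'; exact absurd hcol' (ups_ne_neg hu hu')

/-- Vertices whose levels are pinned by equal model pairs coincide. [folklore] -/
theorem eq_of_pair_eq {z : Site 2} {v v' : slab111 k} {σ : ℤ} (hc : rcol z v = rcol z v') (hl : lev (v : Site 3) = levOfExt k σ)
    (hl' : lev (v' : Site 3) = levOfExt k σ) : v = v' :=
  eq_of_sh_eq_of_lev_eq (by rw [sh_eq_vcol_rcol z v, sh_eq_vcol_rcol z v', hc]) (by rw [hl, hl'])

/-! ## §2 Realizability of certified terminals -/

/-- **Certified terminals pass `realizableItem`.** [cite: DuminilCopinSidoraviciusTassion2016, §2.3 (proof of Fact 2: u', v', w')] -/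
theorem realizable_of_terminals {z : Site 2} {tR tD sR sD : ℕ} (hk : 10 ≤ k) {E₁ E₂ w' : slab111 k}
    (hT : (hexShadow k).Terminals 3 z tR tD sR
      (Wset k z (rkey tR tD sR sD).tR (rkey tR tD sR sD).tD (rkey tR tD sR sD).sR (rkey tR tD sR sD).sD) E₁ E₂ w') :
    Srch.realizableItem (CtxT.of (Ctx.of (rkey tR tD sR sD) (cls z) (k % 3))) (rcol z E₁) (rcol z E₂) (rcol z w')
      (statusOf k (lev (E₁ : Site 3))) (statusOf k (lev (E₂ : Site 3))) (statusOf k (lev (w' : Site 3))) = true := by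
  set K := rkey tR tD sR sD with hK
  set C := CtxT.of (Ctx.of K (cls z) (k % 3)) with hC
  set c1 := rcol z E₁; set c2 := rcol z E₂; set c3 := rcol z w'
  set s1 := statusOf k (lev (E₁ : Site 3)); set s2 := statusOf k (lev (E₂ : Site 3)); set s3 := statusOf k (lev (w' : Site 3))
  have hk5 : 5 ≤ k := by omega
  obtain ⟨hne, hE₁W, hE₂W, hE₁R, hE₂R, hE₁z, hE₂z, hw'W, hw'z, hw'E₁, hw'E₂, hnbrs⟩ := hT
  obtain ⟨o₁, a₁, a₂, o₂, ho₁E, hEa₁, ha₂E, hEo₂, ho₁W, ho₂W, hwo₁, hwa₁, hwa₂, hwo₂, hao₁, haE₂, hao₂, haE₁, hoo, hoa₂, hao₂', haa, hwo₁', hwa₁', hwa₂', hwo₂'⟩ := hnbrs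
  simp only [hexShadow_sh] at *
  have h10 : 0 ≤ lev (E₁ : Site 3) ∧ lev (E₁ : Site 3) ≤ k := ⟨(exists_eq_vl E₁).1.2.1, (exists_eq_vl E₁).1.2.2⟩
  have h20 : 0 ≤ lev (E₂ : Site 3) ∧ lev (E₂ : Site 3) ≤ k := ⟨(exists_eq_vl E₂).1.2.1, (exists_eq_vl E₂).1.2.2⟩
  have h30 : 0 ≤ lev (w' : Site 3) ∧ lev (w' : Site 3) ≤ k := ⟨(exists_eq_vl w').1.2.1, (exists_eq_vl w').1.2.2⟩
  have hb1 := inBlkB_cap_of_mem_blkR hE₁R; have hb2 := inBlkB_cap_of_mem_blkR hE₂R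
  have hc1R : c1.1 ≤ ((cap3 tR : ℕ) : ℤ) := by simp only [inBlkB, Bool.and_eq_true, decide_eq_true_eq] at hb1; exact hb1.1.2
  have hc2R : c2.1 ≤ ((cap3 tR : ℕ) : ℤ) := by simp only [inBlkB, Bool.and_eq_true, decide_eq_true_eq] at hb2; exact hb2.1.2
  -- column inequalities from shadows
  have colne : ∀ {x y : slab111 k}, sh x ≠ sh y → rcol z x ≠ rcol z y := by
    intro x y h e; apply h; rw [sh_eq_vcol_rcol z x, sh_eq_vcol_rcol z y, e]
  have col0 : ∀ {x : slab111 k}, sh x ≠ z → rcol z x ≠ (0, 0) := by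
    intro x h e; apply h; rw [sh_eq_vcol_rcol z x, e]; ext i; fin_cases i <;> simp [vcol]
  -- the three candidacies
  have he1 := ecandSt_of_terminal hk hE₁W hE₁R hE₁z ho₁E.symm ho₁W hwo₁
  have he2 := ecandSt_of_terminal hk hE₂W hE₂R hE₂z hEo₂ ho₂W hwo₂
  have hw3 := wcandSt_of_terminal (tR := tR) (tD := tD) (sR := sR) (sD := sD) hk hw'W hw'z
  -- model pairs of the four neighbours
  obtain ⟨uo₁, ho₁nb, ho₁rep, ho₁0, ho₁12, ho₁win, ho₁lev⟩ := model_pair (tD := tD) (sR := sR) (sD := sD) hk ho₁E.symm hc1R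
  obtain ⟨ua₁, ha₁nb, ha₁rep, ha₁0, ha₁12, ha₁win, ha₁lev⟩ := model_pair (tD := tD) (sR := sR) (sD := sD) hk hEa₁ hc1R
  obtain ⟨ua₂, ha₂nb, ha₂rep, ha₂0, ha₂12, ha₂win, ha₂lev⟩ := model_pair (tD := tD) (sR := sR) (sD := sD) hk ha₂E.symm hc2R
  obtain ⟨uo₂, ho₂nb, ho₂rep, ho₂0, ho₂12, ho₂win, ho₂lev⟩ := model_pair (tD := tD) (sR := sR) (sD := sD) hk hEo₂ hc2R
  -- outside-ness of the o's in the model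
  have ho₁out : Srch.inWs C (rcol z o₁) (Srch.nbrStatus s1 uo₁) = false := by
    by_contra h; rw [Bool.not_eq_false] at h
    exact ho₁W (mem_W_of_inWs hk h (sh_eq_vcol_rcol z o₁) rfl ho₁rep)
  have ho₂out : Srch.inWs C (rcol z o₂) (Srch.nbrStatus s2 uo₂) = false := by
    by_contra h; rw [Bool.not_eq_false] at h
    exact ho₂W (mem_W_of_inWs hk h (sh_eq_vcol_rcol z o₂) rfl ho₂rep)
  -- the witness pairs
  set po₁ : Col × ℤ := (rcol z o₁, Srch.nbrStatus s1 uo₁)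
  set pa₁ : Col × ℤ := (rcol z a₁, Srch.nbrStatus s1 ua₁)
  set pa₂ : Col × ℤ := (rcol z a₂, Srch.nbrStatus s2 ua₂)
  set po₂ : Col × ℤ := (rcol z o₂, Srch.nbrStatus s2 uo₂)
  have hpa₁o₁ : pa₁ ≠ po₁ := fun e => hao₁ (nbr_eq_of_rcol_eq hEa₁ ho₁E.symm (congrArg Prod.fst e))
  have hpa₂o₂ : pa₂ ≠ po₂ := fun e => hao₂ (nbr_eq_of_rcol_eq ha₂E.symm hEo₂ (congrArg Prod.fst e))
  -- single-witness statements
  have W1ne : ∀ excl, pa₁ ∉ excl → (po₁, pa₁) ∈ Srch.witnesses C c1 s1 c3 excl := fun excl hx =>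
    mem_witnesses ho₁nb ho₁0 ho₁12 (ho₁win hwo₁) ho₁out (colne hwo₁'.symm) ha₁nb ha₁0 ha₁12 (ha₁win hwa₁) hpa₁o₁ (colne hwa₁'.symm) hx
  have W2ne : ∀ excl, pa₂ ∉ excl → (po₂, pa₂) ∈ Srch.witnesses C c2 s2 c3 excl := fun excl hx =>
    mem_witnesses ho₂nb ho₂0 ho₂12 (ho₂win hwo₂) ho₂out (colne hwo₂'.symm) ha₂nb ha₂0 ha₂12 (ha₂win hwa₂) hpa₂o₂ (colne hwa₂'.symm) hx
  -- the witness clause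
  have hwc : Srch.witnessClause C c1 c2 c3 s1 s2 = true := by
    unfold Srch.witnessClause
    split_ifs with hboth
    · -- both exact, same side: joint witnesses; equal model pairs are equal vertices
      simp only [Srch.bothExactSameSide, Bool.and_eq_true, bne_iff_ne, ne_eq] at hboth
      obtain ⟨⟨hx1, hx2⟩, -⟩ := hboth
      have pin : ∀ {v v' : slab111 k} {p p' : Col × ℤ}, p = (rcol z v, p.2) → p' = (rcol z v', p'.2) → lev (v : Site 3) = levOfExt k p.2 →
          lev (v' : Site 3) = levOfExt k p'.2 → p = p' → v = v' := by
        intro v v' p p' hp hp' hl hl' e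
        have hc : rcol z v = rcol z v' := by have := congrArg Prod.fst e; rw [hp, hp'] at this; simpa using this
        have hs : p.2 = p'.2 := congrArg Prod.snd e
        exact eq_of_pair_eq hc hl (hs ▸ hl')
      have hm1 : (po₁, pa₁) ∈ Srch.witnesses C c1 s1 c3 [(c2, (s2 : ℤ))] := by
        refine W1ne _ ?_
        simp only [List.mem_singleton]
        exact fun e => haE₂ (pin rfl rfl (ha₁lev hx1) (lev_eq_levOfExt hk5 h20.1 h20.2 hx2) e)
      have hm2 : (po₂, pa₂) ∈ Srch.witnesses C c2 s2 c3 [(c1, (s1 : ℤ))] := by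
        refine W2ne _ ?_
        simp only [List.mem_singleton]
        exact fun e => haE₁ (pin rfl rfl (ha₂lev hx2) (lev_eq_levOfExt hk5 h10.1 h10.2 hx1) e)
      unfold Srch.jointOK
      rw [List.any_eq_true]
      refine ⟨(po₁, pa₁), hm1, ?_⟩
      rw [List.any_eq_true]
      refine ⟨(po₂, pa₂), hm2, ?_⟩
      unfold Srch.pairConds
      simp only [Bool.and_eq_true, Bool.or_eq_true, Bool.not_eq_true', beq_eq_false_iff_ne, ne_eq, beq_iff_eq]
      refine ⟨⟨⟨fun e => hoo (pin rfl rfl (ho₁lev hx1) (ho₂lev hx2) e), fun e => hoa₂ (pin rfl rfl (ho₁lev hx1) (ha₂lev hx2) e)⟩,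
        fun e => hao₂' (pin rfl rfl (ha₁lev hx1) (ho₂lev hx2) e)⟩, ?_⟩
      by_cases e : pa₁ = pa₂
      · right
        have hz := haa (pin rfl rfl (ha₁lev hx1) (ha₂lev hx2) e)
        show rcol z a₁ = (0, 0)
        unfold rcol; rw [hz]; simp
      · exact Or.inl e
    · -- otherwise: single witnesses for the exact terminals
      rw [Bool.and_eq_true, Bool.or_eq_true, Bool.or_eq_true]
      constructor
      · by_cases h : s1 = 9
        · left; simp [h]
        · right; rw [Bool.not_eq_true', List.isEmpty_eq_false_iff]; exact List.ne_nil_of_mem (W1ne _ (by simp))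
      · by_cases h : s2 = 9
        · left; simp [h]
        · right; rw [Bool.not_eq_true', List.isEmpty_eq_false_iff]; exact List.ne_nil_of_mem (W2ne _ (by simp))
  -- assemble
  unfold Srch.realizableItem
  -- E₁ ≠ E₂ when on one column with equal exact status
  have h7 : (!(c1 == c2 && s1 == s2 && s1 != 9)) = true := by
    cases h : (c1 == c2 && s1 == s2 && s1 != 9)
    · rfl
    · exfalso
      simp only [Bool.and_eq_true, beq_iff_eq, bne_iff_ne, ne_eq] at h
      obtain ⟨⟨hc12, hs12⟩, hs9⟩ := h
      have hs9' : s2 ≠ 9 := hs12 ▸ hs9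
      have hl1 := lev_eq_levOfExt hk5 h10.1 h10.2 hs9
      have hl2 := lev_eq_levOfExt hk5 h20.1 h20.2 hs9'
      exact hne (eq_of_pair_eq (σ := (s1 : ℤ)) hc12 hl1 (by rw [hs12]; exact hl2))
  unfold Srch.pairOK
  simp only [Bool.and_eq_true]
  exact ⟨⟨⟨⟨⟨⟨⟨he1, he2⟩, h7⟩, hwc⟩, hw3⟩, by simpa using col0 hw'z⟩, by simpa using colne hw'E₁⟩, by simpa using colne hw'E₂⟩

/-! ## §3 Membership in the searched configuration and need lists -/

/-- The residue context of `(cls z, k % 3)` is among the nine searched contexts of a type. [folklore] -/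
theorem sctx_mem_sctxs (K : BKey) (z : Site 2) (k : ℕ) : Srch.SCtx.of (Ctx.of K (cls z) (k % 3)) ∈ Srch.sctxs K := by
  have hc : cls z < 3 := by unfold cls; omega
  have hr : k % 3 < 3 := Nat.mod_lt _ (by norm_num)
  unfold Srch.sctxs Ctx.of
  simp only [List.mem_flatMap, List.mem_map, List.mem_cons, List.not_mem_nil, or_false]
  exact ⟨cls z, by omega, k % 3, by omega, rfl⟩

/-- The context of a searched context. [folklore] -/
theorem sctx_of_C (C : Ctx) : (Srch.SCtx.of C).C = C := rfl

/-- A realizable status triple of listed statuses is a need item. [folklore] -/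
theorem item_mem_needItems {T : CtxT} {c1 c2 c3 : Col} {s1 s2 s3 : ℕ} (h1 : s1 ∈ Srch.STATUSES) (h2 : s2 ∈ Srch.STATUSES)
    (h3 : s3 ∈ Srch.STATUSES) (hr : Srch.realizableItem T c1 c2 c3 s1 s2 s3 = true) : (s1, s2, s3) ∈ Srch.needItems T c1 c2 c3 := by
  have hr' := hr
  unfold Srch.realizableItem at hr'
  simp only [Bool.and_eq_true, Bool.not_eq_true', beq_eq_false_iff_ne, ne_eq] at hr'
  obtain ⟨⟨⟨⟨hp, hw3⟩, h30⟩, h31⟩, h32⟩ := hr'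
  have hp' := hp
  unfold Srch.pairOK at hp'
  simp only [Bool.and_eq_true] at hp'
  obtain ⟨⟨⟨he1, he2⟩, -⟩, -⟩ := hp'
  unfold Srch.needItems
  have hcond : ¬ ((c3 == (0,0) || c3 == c1 || c3 == c2) = true) := by simp [h30, h31, h32]
  rw [if_neg hcond]
  simp only [List.mem_flatMap, List.mem_filterMap, List.mem_filter, List.mem_map]
  exact ⟨(s1, s2), ⟨s1, ⟨h1, he1⟩, s2, ⟨h2, he2⟩, by simp [hp]⟩, s3, ⟨h3, hw3⟩, rfl⟩

/-- A configuration carrying a realizable status triple (for some searched residue) has candidate columns and is not excluded. [folklore] -/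
theorem cols_of_realizable {SS : List Srch.SCtx} {S : Srch.SCtx} (hS : S ∈ SS) {c1 c2 c3 : Col} {s1 s2 s3 : ℕ}
    (hc1 : c1 ∈ Srch.hexCols) (hc2 : c2 ∈ Srch.hexCols) (hc3 : c3 ∈ Srch.hexCols)
    (h1 : s1 ∈ Srch.STATUSES) (h2 : s2 ∈ Srch.STATUSES) (h3 : s3 ∈ Srch.STATUSES)
    (hr : Srch.realizableItem S.T c1 c2 c3 s1 s2 s3 = true) :
    c1 ∈ Srch.eCols SS ∧ c2 ∈ Srch.eCols SS ∧ c3 ∈ Srch.wCols SS ∧ Srch.excluded c1 c2 c3 = false := by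
  unfold Srch.realizableItem at hr
  simp only [Bool.and_eq_true, Bool.not_eq_true', beq_eq_false_iff_ne, ne_eq] at hr
  obtain ⟨⟨⟨⟨hp, hw3⟩, h30⟩, h31⟩, h32⟩ := hr
  unfold Srch.pairOK at hp
  simp only [Bool.and_eq_true] at hp
  obtain ⟨⟨⟨he1, he2⟩, -⟩, -⟩ := hp
  unfold Srch.eCols Srch.wCols Srch.excluded
  simp only [List.mem_filter, List.any_eq_true]
  exact ⟨⟨hc1, S, hS, s1, h1, he1⟩, ⟨hc2, S, hS, s2, h2, he2⟩, ⟨hc3, S, hS, s3, h3, hw3⟩, by simp [h30, h31, h32]⟩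

/-- **The terminals of the node have candidate columns (not excluded) and a needed status item** (reduced key, residue context of `z` and `k`).
[cite: DuminilCopinSidoraviciusTassion2016, §2.3 (proof of Fact 2: u', v', w')] -/
theorem cfg_item_of_terminals {z : Site 2} {tR tD sR sD : ℕ} (hk : 10 ≤ k) {E₁ E₂ w' : slab111 k}
    (hT : (hexShadow k).Terminals 3 z tR tD sR
      (Wset k z (rkey tR tD sR sD).tR (rkey tR tD sR sD).tD (rkey tR tD sR sD).sR (rkey tR tD sR sD).sD) E₁ E₂ w') :
    (rcol z E₁ ∈ Srch.eCols (Srch.sctxs (rkey tR tD sR sD)) ∧ rcol z E₂ ∈ Srch.eCols (Srch.sctxs (rkey tR tD sR sD)) ∧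
      rcol z w' ∈ Srch.wCols (Srch.sctxs (rkey tR tD sR sD)) ∧ Srch.excluded (rcol z E₁) (rcol z E₂) (rcol z w') = false) ∧
    (statusOf k (lev (E₁ : Site 3)), statusOf k (lev (E₂ : Site 3)), statusOf k (lev (w' : Site 3))) ∈
      Srch.needItems (CtxT.of (Ctx.of (rkey tR tD sR sD) (cls z) (k % 3))) (rcol z E₁) (rcol z E₂) (rcol z w') := by
  have hr := realizable_of_terminals hk hT
  have hk5 : 5 ≤ k := by omega
  have h1 := statusOf_mem_STATUSES hk5 (exists_eq_vl E₁).1.2.1 (exists_eq_vl E₁).1.2.2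
  have h2 := statusOf_mem_STATUSES hk5 (exists_eq_vl E₂).1.2.1 (exists_eq_vl E₂).1.2.2
  have h3 := statusOf_mem_STATUSES hk5 (exists_eq_vl w').1.2.1 (exists_eq_vl w').1.2.2
  refine ⟨?_, item_mem_needItems h1 h2 h3 hr⟩
  have hc1 : rcol z E₁ ∈ Srch.hexCols := rcol_mem_hexCols (tnZ_le_of_inBlkB (inBlkB_cap_of_mem_blkR hT.E₁R))
  have hc2 : rcol z E₂ ∈ Srch.hexCols := rcol_mem_hexCols (tnZ_le_of_inBlkB (inBlkB_cap_of_mem_blkR hT.E₂R))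
  have hw : (hexShadow k).sh w' ∈ blkR 3 z (rkey tR tD sR sD).tD (rkey tR tD sR sD).sD := by rw [blkR_three]; exact hT.w'W.1
  have hc3 : rcol z w' ∈ Srch.hexCols := rcol_mem_hexCols (tnZ_le_of_inBlkB (inBlkB_cap_of_mem_blkR hw))
  exact cols_of_realizable (sctx_mem_sctxs _ z k) hc1 hc2 hc3 h1 h2 h3 hr

end Slab111

end Summit.CriticalPhenomena.PercolationContinuityZ3.Theorems.Transplant

end
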